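import Literature.Geometry.Lorentzian.AsymptoticallyFlatCompleteness
import HarnessLib

/-!
# The Ricci variation of Schoen–Yau: choosing `t₀ < 0`

Step 2 of the proof of positive mass rigidity (Schoen–Yau, Comm. Math. Phys. 65 (1979), Thm. 2;
§3, pp. 72–74) is vendored in `Literature.Geometry.Lorentzian.PositiveMassRigidity` as the named
fact `exists_ricciVariation_negativeMass_of_massZero`: for an oriented, one-ended, strongly
asymptotically flat `3`-manifold with mass parameter `0`, `R ≡ 0` and `Ric ≢ 0`, *some* `t₀ < 0`
and *some* positive `φ` make `φ⁴ (h + t₀ Ric)` asymptotically Schwarzschildean of negative mass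
and scalar flat (which Thm. 1 forbids). The printed argument producing `t₀` has two parts of a
very different nature:

1. **Geometric analysis** (pp. 72–74 up to (3.30)): the metrics `ds²_t = ds² + t Ric` are
   asymptotically flat for `|t|` small; `R'₀ = -‖Ric‖²` ((3.24)–(3.25)); Lemma 3.3 (through the
   linear theory of Lemmas 3.1–3.2) yields positive `φ_t` with `φ_t⁴ ds²_t` asymptotically flat
   and scalar flat, of total mass `M(t)` given by (3.26); and `M` is differentiable at `t = 0`
   ((3.27)–(3.29)) with `M'(0) = c ∫_N ‖Ric‖² dx`, `c > 0` ((3.30)), while `M(0) = 0`.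
2. **One-variable calculus** (p. 74, last paragraph: *"(3.30) implies that `M'(0) > 0` and hence
   by choosing a suitable `t₀ < 0` we would have `M(t₀) < 0`"*): a real function vanishing at `0`
   with positive derivative there is negative somewhere in every interval `(-τ, 0)`.

This file **proves** part 2 (`exists_lt_zero_of_hasDerivAt_pos`, slopes). Part 1 is assembled in
`RicciVariationEllipticSteps.lean`: the family, its asymptotic flatness, the first variation
`R'₀ = -‖Ric‖²` and `0 < ∫ ‖Ric‖² < ∞` are proved there and in the files it imports, and the
named fact is reduced (`exists_ricciVariation_negativeMass_of_massZero_of_elliptic_steps`) to the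
two genuinely analytic steps — Lemma 3.3 applied to the family, and the differentiation
(3.27)–(3.30) of the mass integral — with the mass function (3.26)–(3.30) as the proved
intermediate `exists_ricciVariation_massFunctionAt_of_elliptic_steps`. (History: the mass
function was for a while packaged here as a separate named fact,
`exists_ricciVariation_massFunction_of_massZero`; it was the parent fact minus part 2, not a
distinct published result, and was merged back under the decomposition discipline D-0026.)

## References

* R. Schoen, S.-T. Yau, *On the proof of the positive mass conjecture in general relativity*,
  Comm. Math. Phys. 65 (1979) 45–76: Thm. 2 (p. 48); §3, (3.24)–(3.30) and the last paragraph of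
  the proof of Thm. 2 (pp. 73–74).
-/

noncomputable section

open Set Filter
open scoped Topology

namespace Literature.Geometry.Lorentzian

/-! ### Schoen–Yau 1979, p. 74, last paragraph: choosing `t₀ < 0` -/

/-- **A function vanishing at `0` with positive derivative there is negative somewhere in every
left neighbourhood of `0`**: if `M(0) = 0`, `M` has derivative `M' > 0` at `0` and `τ > 0`,
then `M(t₀) < 0` for some `t₀ ∈ (-τ, 0)` (the slopes `M(t)/t` tend to `M' > 0` as `t → 0⁻`,
so some `t₀ ∈ (-τ, 0)` has `M(t₀)/t₀ > 0`). This is the calculus behind "by choosing a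
suitable `t₀ < 0` we would have `M(t₀) < 0`" (Schoen–Yau 1979, p. 74). [folklore] -/
theorem exists_lt_zero_of_hasDerivAt_pos {M : ℝ → ℝ} {M' τ : ℝ} (hM : HasDerivAt M M' 0)
    (hM0 : M 0 = 0) (hM' : 0 < M') (hτ : 0 < τ) :
    ∃ t₀ : ℝ, -τ < t₀ ∧ t₀ < 0 ∧ M t₀ < 0 := by
  have h1 : Tendsto (slope M 0) (𝓝[<] 0) (𝓝 M') :=
    (hasDerivAt_iff_tendsto_slope.1 hM).mono_left (nhdsLT_le_nhdsNE 0)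
  have h2 : ∀ᶠ t in 𝓝[<] (0 : ℝ), 0 < slope M 0 t := h1.eventually_const_lt hM'
  have h3 : ∀ᶠ t in 𝓝[<] (0 : ℝ), t ∈ Ioo (-τ) 0 := Ioo_mem_nhdsLT (neg_lt_zero.2 hτ)
  obtain ⟨t₀, h0, hτ', hlt⟩ := (h2.and h3).exists
  refine ⟨t₀, hτ', hlt, ?_⟩
  rw [slope_def_field, hM0, sub_zero, sub_zero] at h0
  rcases div_pos_iff.1 h0 with ⟨-, ht⟩ | ⟨hMt, -⟩
  · exact absurd ht (not_lt.2 hlt.le)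
  · exact hMt

end Literature.Geometry.Lorentzian

end
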